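import Summits.CriticalPhenomena.PercolationContinuityZ3.Theorems.PercNearOneGluingNoHeavyLowerTailKNGoodGMgcTarget
import Summits.CriticalPhenomena.PercolationContinuityZ3.Theorems.PercNearOneGluingNoHeavyLowerTailKNGoodGMgcBlobCert
import HarnessLib

/-!
# Blob target expansion: the goodness functional of the fully contracted observer `[xyz]` equals `Σ_v Ψ_v(j) · v`
# (`NoHeavyLowerTail` cell, stmt-CriticalPhenomena-4575; prover `prim-hp-2`, gen 19 — KEY3 of MEMO-gen19 §6–7, semantic half in contracted form)

Support file (`--supports stmt-CriticalPhenomena-4575`; imports the COMPUTATIONAL `…Target` / `…BlobCert`).  No definitions, no named facts,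
no sorries.  With `û = u[s(x,z) ↦ 1]` (still a pendant side) the contraction `u'' = û[s(x,y) ↦ 1]` glues all three children; THEOREM B's
`Verts.target_expansion` for `û` together with `X̂ 10 = 1` collapses `phiHat j r` to the blob cell table `blobHat j` (the `z`-pair `xz` is
open at every configuration: no pocket `{x,y}`, no reference relay):
* `bexp_update_true_of_one` — a bit of weight `1` is surely on;  `phiHat_update_ten` — `phiHat j r (c[10 ↦ true]) = blobHat j c`;
* **`Verts.blob_target_expansion`** — the goodness functional of `x` in `u[s(x,z) ↦ 1][s(x,y) ↦ 1]` at the witness `relay j` equals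
  `Σ_{v=0..4} blobCoef j v X · v_v` (`v` the five core scalars, `a₁` the core-loneliest relay).
With `…BlobCert.blob_free_j*` this gives the blob kernel in CONTRACTED form; the forced form needed by `…ThreeChildren.hkey3` is the corner
`(1,1,1)` translation (next file).
-/

noncomputable section

namespace Summit.CriticalPhenomena.PercolationContinuityZ3.Theorems

namespace KNGoodGMgc

open MeasureTheory Set Literature.Probability.LatticeModels Literature.Probability.Percolation KNGoodAux
open scoped Classical BigOperators

variable {n : ℕ}

/-- A bit of weight `1` is surely on: the integrand may be pre-composed with switching it on. [folklore] -/
theorem bexp_update_true_of_one (k : ℕ) (x : ℕ → ℝ) (hk : x k = 1) :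
    ∀ (m : ℕ) (f : Cfg → ℤ), k < m → bexp m f x = bexp m (fun c => f (Function.update c k true)) x
  | 0, _, h => absurd h (Nat.not_lt_zero _)
  | m + 1, f, h => by
    rcases Nat.lt_succ_iff_lt_or_eq.1 h with hlt | rfl
    · rw [bexp_succ, bexp_succ]
      have hne : m ≠ k := Nat.ne_of_gt hlt
      rw [bexp_update_true_of_one k x hk m _ hlt, bexp_update_true_of_one k x hk m (fun c => f (Function.update c m true)) hlt]
      simp only [Function.update_comm hne]
    · rw [bexp_succ, bexp_succ, hk]
      simp only [sub_self, zero_mul, one_mul, zero_add, Function.update_idem]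

/-- With the pair `xz` open, THEOREM B's cell table is the blob cell table. [this work] -/
theorem phiHat_update_ten (j r : ℕ) (c : Cfg) : phiHat j r (Function.update c 10 true) = blobHat j c := by
  simp [phiHat, blobHat, blobS, hitO, hitX, hitY, hitZ]

/-- `blobHat` reads only bits below `9`. [this work] -/
theorem blobHat_dep (j : ℕ) (v : Fin 5) : DepOn (fun i => i < 9) (fun c => blobHat j c v) := by
  intro c c' h
  simp only [blobHat, blobS, hitX, hitY, hitZ, h 0 (by norm_num), h 1 (by norm_num), h 2 (by norm_num), h 3 (by norm_num),
    h 4 (by norm_num), h 5 (by norm_num), h 6 (by norm_num), h 7 (by norm_num), h 8 (by norm_num)]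

namespace Verts

variable (V : Verts n) {u : Sym2 (Fin n) → unitInterval} (hP : V.Pendant u) (b : Fin n)
  (hb : b ∉ ({V.x, V.y, V.z} : Finset (Fin n)))
include hP hb

omit hb in
/-- Raising the pair `xz` keeps the side pendant. [this work] -/
theorem pendant_update_xz (t : unitInterval) : V.Pendant (Function.update u (V.e 10) t) := by
  have hx := hP.hx; have hy := hP.hy; have hz := hP.hz
  refine ⟨fun s h1 h2 h3 h4 h5 => ?_, fun s h1 h2 h3 h4 h5 => ?_, fun s h1 h2 h3 h4 h5 => ?_⟩
  · rw [Function.update_of_ne, hx s h1 h2 h3 h4 h5]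
    rw [V.e_10]; intro h
    rcases Sym2.eq_iff.1 h with ⟨-, h'⟩ | ⟨h', h''⟩
    · exact h5 h'
    · exact h5 (h''.trans h')
  · rw [Function.update_of_ne, hy s h1 h2 h3 h4 h5]
    rw [V.e_10]; intro h
    rcases Sym2.eq_iff.1 h with ⟨h', -⟩ | ⟨h', -⟩
    · exact V.hxy h'.symm
    · exact V.hyz h'
  · rw [Function.update_of_ne, hz s h1 h2 h3 h4 h5]
    rw [V.e_10]; intro h
    rcases Sym2.eq_iff.1 h with ⟨h', -⟩ | ⟨-, h''⟩
    · exact V.hxz h'.symm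
    · exact h4 h''

omit hP hb in
/-- Raising the pair `xz` does not change the core. [this work] -/
theorem core_update_xz (t : unitInterval) : V.core (Function.update u (V.e 10) t) = V.core u := by
  funext f
  unfold Verts.core
  by_cases hx : V.x ∈ f
  · simp [hx]
  · have hne : f ≠ s(V.x, V.z) := by intro h; rw [h] at hx; exact hx (Sym2.mem_mk_left _ _)
    simp [hx, Function.update_of_ne hne]

omit hP hb in
/-- Raising the pair `xz` does not change the glued cores. [this work] -/
theorem R_update_xz (t : unitInterval) (π i : ℕ) : V.R (Function.update u (V.e 10) t) b π i = V.R u b π i := by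
  unfold Verts.R Verts.rel Verts.glued
  rw [V.core_update_xz t]

/-- **Blob target expansion.**  With `û = u[xz ↦ 1]` and `u'' = û[xy ↦ 1]` (all three children glued), witness `relay j`, `a₁` loneliest in the
core: the goodness functional of `x` in `u''` equals `Σ_v blobCoef j v X · v_v`. [this work] -/
theorem blob_target_expansion (j : ℕ) (hj : j = 1 ∨ j = 2 ∨ j = 3) (hA : ({V.a₁, V.a₂, V.a₃} : Finset (Fin n)).Nonempty)
    (hs1 : ∀ a ∈ ({V.a₁, V.a₂, V.a₃} : Finset (Fin n)),
      (prodBernoulli (V.core u)).real (openConn V.a₁ b) ≤ (prodBernoulli (V.core u)).real (openConn a b)) :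
    (prodBernoulli (Function.update (Function.update u (V.e 10) 1) (V.e 11) 1)).real (openConn V.x b) -
        (prodBernoulli (Function.update (Function.update u (V.e 10) 1) (V.e 11) 1)).real (openConn (V.relay j) b) +
        ∑ W ∈ nullSets ({V.a₁, V.a₂, V.a₃} : Finset (Fin n)),
          (prodBernoulli (Function.update (Function.update u (V.e 10) 1) (V.e 11) 1)).real (clusterIs V.x W) *
            ({V.a₁, V.a₂, V.a₃} : Finset (Fin n)).inf' hA
              (fun a => (prodBernoulli (Function.update (Function.update u (V.e 10) 1) (V.e 11) 1)).real
                (openConnIn ((↑W : Set (Fin n))ᶜ) a b)) =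
      blobCoef j 0 (V.X u) * (V.R u b 0 2 - V.R u b 0 1) + blobCoef j 1 (V.X u) * (V.R u b 0 3 - V.R u b 0 2) +
      blobCoef j 2 (V.X u) * (V.R u b 5 1 - V.R u b 5 2) + blobCoef j 3 (V.X u) * (V.R u b 6 2 - V.R u b 6 1) +
      blobCoef j 4 (V.X u) * (V.R u b 3 1 - V.R u b 3 3) := by
  set uh := Function.update u (V.e 10) 1 with huh
  have hPh : V.Pendant uh := V.pendant_update_xz hP 1
  -- a reference relay for the (empty) pocket `{x,y}`
  obtain ⟨r₀, hr₀A, hr₀min⟩ := ({V.a₁, V.a₂, V.a₃} : Finset (Fin n)).exists_min_image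
    (fun a => (prodBernoulli (restrW ((↑({V.x, V.y} : Finset (Fin n)) : Set (Fin n))ᶜ) (Function.update uh (V.e 11) 1))).real
      (openConn a b)) hA
  have hidx : ∃ i : ℕ, (i = 1 ∨ i = 2 ∨ i = 3) ∧ V.relay i = r₀ := by
    simp only [Finset.mem_insert, Finset.mem_singleton] at hr₀A
    rcases hr₀A with rfl | rfl | rfl
    · exact ⟨1, Or.inl rfl, rfl⟩
    · exact ⟨2, Or.inr (Or.inl rfl), rfl⟩
    · exact ⟨3, Or.inr (Or.inr rfl), rfl⟩
  obtain ⟨r, hr, hrel⟩ := hidx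
  rw [← hrel] at hr₀min
  have hs1' : ∀ a ∈ ({V.a₁, V.a₂, V.a₃} : Finset (Fin n)),
      (prodBernoulli (V.core uh)).real (openConn V.a₁ b) ≤ (prodBernoulli (V.core uh)).real (openConn a b) := by
    rw [huh, V.core_update_xz 1]; exact hs1
  have hT := V.target_expansion hPh b hb j r hj hr hA hr₀min hs1'
  rw [hT]
  -- the coefficients: `X̂ 10 = 1` collapses `phiHat j r` to `blobHat j`
  have hX10 : V.X uh 10 = 1 := by unfold Verts.X; rw [huh, Function.update_self]; rfl
  have hXlow : ∀ k, k < 9 → V.X uh k = V.X u k := by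
    intro k hk
    have hne : V.e k ≠ V.e 10 := V.e_inj k 10 (by omega) (by norm_num) (by omega)
    unfold Verts.X; rw [huh, Function.update_of_ne hne]
  have hcoef : ∀ v : Fin 5, bexp 11 (fun c => phiHat j r c v) (V.X uh) = blobCoef j v (V.X u) := by
    intro v
    rw [bexp_update_true_of_one 10 (V.X uh) hX10 11 _ (by norm_num)]
    simp only [phiHat_update_ten]
    unfold blobCoef
    rw [bexp_of_dep_lt 9 _ (blobHat_dep j v) 11 (by norm_num)]
    rw [← bexpR_intCast, ← bexpR_intCast]
    exact bexpR_congr_weights 9 _ _ _ fun k hk => hXlow k hk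
  rw [hcoef 0, hcoef 1, hcoef 2, hcoef 3, hcoef 4]
  simp only [huh, V.R_update_xz]

end Verts

end KNGoodGMgc

end Summit.CriticalPhenomena.PercolationContinuityZ3.Theorems

end
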